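import Literature.MathematicalPhysics.PowerSystems.DVOCCollectiveAmplitudeBarrier
import Literature.Analysis.ODE.MaxLyapunovInvariance
import HarnessLib

/-!
# Forward invariance of the collective-amplitude region `Ω = {½‖P_Sv‖² ≤ d²/2} ∩ {r² ≥ ρ²}` of the reduced
# dVOC network, regional exponential synchronisation `‖v(t)‖²_S ≤ e^{−2ηct}‖v(0)‖²_S`, and the amplitude rate
# `(1 − r(t)²)² ≤ e^{−2ηαρ²t}(1 − r(0)²)² + C e^{−2ηct}‖v(0)‖²_S` on the band `Ω₃` — for every `N` and every gain
# `α`, under the `α`-REDUCED inequality (23) and a positive polynomial barrier (Groß–Colombino–Brouillon–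
# Dörfler 2019, model (17); Colombino–Groß–Brouillon–Dörfler 2019, Prop. 11 as the printed analogue)

Topic `Literature/MathematicalPhysics/PowerSystems`, namespace
`Literature.MathematicalPhysics.PowerSystems[.DvocReduced]`; last of the four «collective-amplitude» modules
(`Gate` → `Dynamics` → `Barrier` → **`Region`**). MODELLED column: a priori statements about solutions of the
printed reduced-order model (17), `M = DvocReduced N` (ideal dVOC sources, Kron-reduced quasi-steady-state
network, UNIFORM gain `α` — load-bearing for the cross-term cancellation of Lemma 1♯), in the tree's solution
convention `IsSolutionOn γ (Icc 0 T)` (= `HasDerivWithinAt γ (field (γ t)) (Icc 0 T) t`): every theorem reads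
«every solution DEFINED ON `[0, T]` and starting in the region obeys …» — no existence clause is asserted
(gridfusion-g2-crit-1 condition (g6), STATUS l.10675). Nothing here says that a converter, feeder or grid
is stable; the regions are INNER estimates, O(1) in `N` (e.g. `d²/2 = 0.1458` of total sync-distance in the
cell's 141-bus reading), not large-signal basins; sufficient, not necessary. 0 named facts, 0 `decide`,
instance-free; every statement PROVED. Cell G2-SCALE lead §58 D74 (idea card «idea-2 (cycle 5) /
collective-amplitude-gate-printed-gain-certificate», cruxes K1 REV 4 and K3 REV 6; scratch by
gridfusion-g2-idea-2, `port/DVOCCollectiveAmplitudeGate.lean` 9a6b39836e226557 §4, checked rc 0 by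
gridfusion-g2-crit-1 STATUS l.10652 / l.10675); typed by gridfusion-lit-4 (g15), 2026-08-28. DE-DUPLICATION
against the tree: the scratch's private first-exit-time lemmas are NOT re-proved — `two_face_invariance` is the
two-constraint, mixed-orientation instance (`ι = Bool`, barriers `f ≤ ℓ` and `−g ≤ −ρ²`) of
`Literature.Analysis.ODE.forall_le_of_hasDerivWithinAt_of_eq_imp_deriv_neg` (`MaxLyapunovInvariance.lean`).

## Sources (read on the page)

* [GrossEtAl2019] arXiv:1802.08881 = IEEE TCNS 6 (2019) 1148: model (17) p0006 L9–16; Prop. 3 (25) p0006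
  L96–100; Theorem 2 p0005 L69–76 («almost globally asymptotically stable with respect to 𝒯» under
  Condition 2 — the printed, FULL-gain, almost-global statement; typed in the tree as
  `DVOCReducedConvergence.tendsto_infDist_target_or_tendsto_zero` under `DecreaseOnS c` at gain `α`).
* [ColombinoEtAl2019] arXiv:1710.00694 = IEEE TAC 64 (2019) 4496: §4.3.2 (chunk p0016 tail) «γ_𝒮(γ_𝒜) =
  (v⋆_min/v⋆_max) γ_𝒜(v⋆_min − γ_𝒜)/σ̄(𝒦 − 𝓛) and the set ℳ(γ_𝒜) := {v̄ | ‖v̄‖_𝒮 ≤ γ_𝒮(γ_𝒜), ‖v̄_k‖_{𝒜_k} ≤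
  γ_𝒜 ∀k}», Prop. 11 chunk p0017 L28–32 «Under Condition 1, the set ℳ(γ_𝒜) is non-empty and invariant …
  Broadly speaking, the proof establishes that trajectories stay close to 𝒜 if they start sufficiently close
  to 𝒮 and 𝒜» — the nearest printed statement (per-node amplitude gate, FULL-gain Condition 1).
* The invariance argument: [LinFrancisMaggiore2007, §2.3 Lemma 2.2] as used in the tree's
  `MaxLyapunovInvariance.lean` (first-exit time over finitely many scalar barriers).

## What is printed and what is this file's

PRINTED: Thm 2 (almost-global, Condition 2 at the full gain); [ColombinoEtAl2019, Prop. 11] (a nested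
invariant neighbourhood of `𝒯` under Condition 1). THIS FILE (the idea card's regional statements, proved):
with `Ω(ℓ, ε₁)`, `ℓ = d²/2`, `ε₁ = 1 − ρ²`, hypotheses symmetric `w`, `v_k⋆ ≥ v_min > 0`, `α ≥ 0`, `η > 0`,
`c > 0`, the loading enclosure `Σ_k(σ_k/v_k⋆)² ≤ Σ̄²`, the `Gate` module's `GateDecrease c (ε₁ + ℓ/(4v_min²))`
(= printed (23) at the REDUCED gain) and the `Barrier` module's bracket
`α(ρ²((1−ρ²)Λ − 3d²) − ρd³/v_min) − 2ρdΣ̄ > 0`: `Ω` is forward invariant (`region_invariant`: the face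
`½‖P_Sv‖² = ℓ` is repelling by Prop 3♯, the face `r² = ρ²` by the barrier bound); on `Ω`,
`‖v(t)‖²_S ≤ e^{−2ηct}‖v(0)‖²_S` (`region_exp_decay`); with the mirror bracket at an upper face `ρ₊` the
closed band `Ω₃ = Ω ∩ {r² ≤ ρ₊²}` is forward invariant (`region_invariant₃`) and, for `c < αρ²`,
`(1 − r(t)²)² ≤ e^{−2ηαρ²t}(1 − r(0)²)² + K_r/(αρ²Λ²(αρ² − c))·e^{−2ηct}‖v(0)‖²_S` (`amp_sq_decay`):
phase synchronisation AND common amplitude `r → 1`, i.e. exponential approach to `𝒯 = 𝒮 ∩ 𝒜` from `Ω₃`,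
along every solution defined on `[0, T]`. Nothing in this file certifies a real grid.
-/

noncomputable section

namespace Literature.MathematicalPhysics.PowerSystems

open Finset Real

/-- **Two-face forward invariance** (abstract first-touch lemma on `[0, T]`, two scalar constraints with opposite
orientations). If `f` and `g` have derivatives `f'`, `g'` within `[0, T]`, `f' < 0` wherever `f = ℓ` while
`g ≥ ρ²`, and `g' > 0` wherever `g = ρ²` while `f ≤ ℓ`, then `{f ≤ ℓ} ∩ {g ≥ ρ²}` is forward invariant on
`[0, T]`. This is the case `ι = Bool` (barriers `f ≤ ℓ`, `−g ≤ −ρ²`) of the tree's finite-barrier lemma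
`Literature.Analysis.ODE.forall_le_of_hasDerivWithinAt_of_eq_imp_deriv_neg`; no model content.
[cite: LinFrancisMaggiore2007, §2.3 Lemma 2.2 (as used in the tree's `MaxLyapunovInvariance`)] -/
theorem two_face_invariance {f f' g g' : ℝ → ℝ} {T ℓ ρ2 : ℝ}
    (hf : ∀ t ∈ Set.Icc (0:ℝ) T, HasDerivWithinAt f (f' t) (Set.Icc 0 T) t)
    (hg : ∀ t ∈ Set.Icc (0:ℝ) T, HasDerivWithinAt g (g' t) (Set.Icc 0 T) t)
    (hA : ∀ t ∈ Set.Icc (0:ℝ) T, f t = ℓ → ρ2 ≤ g t → f' t < 0)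
    (hB : ∀ t ∈ Set.Icc (0:ℝ) T, f t ≤ ℓ → g t = ρ2 → 0 < g' t)
    (h0f : f 0 ≤ ℓ) (h0g : ρ2 ≤ g 0) :
    ∀ t ∈ Set.Icc (0:ℝ) T, f t ≤ ℓ ∧ ρ2 ≤ g t := by
  -- the two barriers, indexed by `Bool`: `true ↦ (f ≤ ℓ)`, `false ↦ (−g ≤ −ρ2)`
  have key := Literature.Analysis.ODE.forall_le_of_hasDerivWithinAt_of_eq_imp_deriv_neg
    (h := fun b => cond b f (fun s => -g s)) (h' := fun b s => cond b (f' s) (-g' s))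
    (c := fun b => cond b ℓ (-ρ2)) (T := T) ?_ ?_ ?_
  · intro t ht
    have h1 := key t ht true
    have h2 := key t ht false
    simp only [cond_true, cond_false] at h1 h2
    exact ⟨h1, by linarith⟩
  · intro k t ht
    cases k
    · show HasDerivWithinAt (fun s => -g s) (-g' t) (Set.Icc 0 T) t
      exact (hg t ht).fun_neg
    · show HasDerivWithinAt f (f' t) (Set.Icc 0 T) t
      exact hf t ht
  · intro t ht hall k hk
    have h1 := hall true
    have h2 := hall false
    simp only [cond_true, cond_false] at h1 h2
    cases k
    · simp only [cond_false] at hk ⊢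
      have := hB t ht h1 (by linarith)
      linarith
    · simp only [cond_true] at hk ⊢
      exact hA t ht hk (by linarith)
  · intro k
    cases k
    · simpa only [cond_false] using neg_le_neg h0g
    · simpa only [cond_true] using h0f

namespace DvocReduced

variable {N : ℕ} (W : DvocReduced N)

/-- Pure algebra of the amplitude comparison (scalars only, no model content): with `κ = ηαρ²`,
`u' = −(2η/Λ²)P`, `P = Λ²α·rs·u + R`, `rs ≥ ρ²`, `R² ≤ Λ²K_r n`:  `2κu² + 2uu' ≤ (2ηK_r/(αρ²Λ²))·n`
(Young's inequality `(2η/(αρ²Λ⁴))(αρ²Λ²u + R)² ≥ 0`). Private helper of `amp_sq_decay`. [folklore] -/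
private theorem amp_pointwise {η α Λ ρ u rs P R Kr n : ℝ} (hη : 0 < η) (hα : 0 < α) (hΛ : 0 < Λ) (hρ : 0 < ρ)
    (hrs : ρ ^ 2 ≤ rs) (hR : R = P - Λ ^ 2 * α * (rs * u)) (hR2 : R ^ 2 ≤ Λ ^ 2 * Kr * n) :
    2 * (η * α * ρ ^ 2) * u ^ 2 + 2 * u * (-(2 * η / Λ ^ 2 * P))
      ≤ 2 * η * Kr / (α * ρ ^ 2 * Λ ^ 2) * n := by
  have hP : P = Λ ^ 2 * α * (rs * u) + R := by rw [hR]; ring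
  have hY : 0 ≤ 2 * η / (α * ρ ^ 2 * Λ ^ 4) * (α * ρ ^ 2 * Λ ^ 2 * u + R) ^ 2 := by positivity
  have eY : 2 * η / (α * ρ ^ 2 * Λ ^ 4) * (α * ρ ^ 2 * Λ ^ 2 * u + R) ^ 2
      = 2 * η * α * ρ ^ 2 * u ^ 2 + 4 * η / Λ ^ 2 * u * R + 2 * η / (α * ρ ^ 2 * Λ ^ 4) * R ^ 2 := by
    field_simp
    ring
  have h1 : 2 * u * (-(2 * η / Λ ^ 2 * P)) = -(4 * η * α) * (rs * u ^ 2) - 4 * η / Λ ^ 2 * u * R := by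
    rw [hP]; field_simp; ring
  have h2 : -(4 * η * α) * (rs * u ^ 2) ≤ -(4 * η * α) * (ρ ^ 2 * u ^ 2) := by
    have : ρ ^ 2 * u ^ 2 ≤ rs * u ^ 2 := mul_le_mul_of_nonneg_right hrs (sq_nonneg u)
    nlinarith [mul_pos hη hα]
  have h3 : 2 * η / (α * ρ ^ 2 * Λ ^ 4) * R ^ 2 ≤ 2 * η * Kr / (α * ρ ^ 2 * Λ ^ 2) * n := by
    have e : 2 * η * Kr / (α * ρ ^ 2 * Λ ^ 2) * n = 2 * η / (α * ρ ^ 2 * Λ ^ 4) * (Λ ^ 2 * Kr * n) := by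
      field_simp
    rw [e]
    exact mul_le_mul_of_nonneg_left hR2 (by positivity)
  rw [h1]
  nlinarith [hY, eY, h2, h3]



/-- **Forward invariance of `Ω(ℓ, ε₁) = {½‖P_Sv‖² ≤ d²/2} ∩ {r² ≥ ρ²}`** (`ℓ = d²/2`,
`ε₁ = 1 − ρ²`) along solutions of (17), for every `N`: symmetric weights, `v_k* ≥ v_min > 0`,
`α ≥ 0`, `η > 0`, the reduced-gain inequality (23) at `α(ε₁ + ℓ/(4v_min²))` with margin `c > 0`,
a loading enclosure `Σ_k (σ_k/v_k⋆)² ≤ Σ̄²`, and a positive polynomial barrier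
`α(ρ²((1−ρ²)Λ − 3d²) − ρd³/v_min) − 2ρdΣ̄ > 0`: every solution defined on `[0, T]` with
`½‖P_Sv(0)‖² ≤ d²/2`, `r(0)² ≥ ρ²` keeps both inequalities on `[0, T]` (a priori; inner region; the idea
card's K1 — the printed analogue is the invariant neighbourhood `ℳ(γ_𝒜)` of [ColombinoEtAl2019, Prop. 11]).
[cite: ColombinoEtAl2019, Prop. 11 chunk p0017 L28–32 (printed analogue); GrossEtAl2019 (17) p0006 L9–16] -/
theorem region_invariant (hΛ : W.Lam ≠ 0) (hw : ∀ k j, W.w k j = W.w j k) (hα : 0 ≤ W.α)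
    (hη : 0 < W.η) {vmin ρ d Sb c : ℝ} (hvmin : 0 < vmin) (hv : ∀ k, vmin ≤ W.vref k)
    (hρ : 0 ≤ ρ) (hd : 0 < d) (hSb : 0 ≤ Sb) (hσ : ∑ k, (W.loadSig k / W.vref k) ^ 2 ≤ Sb ^ 2)
    (hc : 0 < c)
    (hBpos : 0 < W.α * (ρ ^ 2 * ((1 - ρ ^ 2) * W.Lam - 3 * d ^ 2) - ρ * d ^ 3 / vmin)
      - 2 * ρ * d * Sb)
    (h23 : W.GateDecrease c ((1 - ρ ^ 2) + d ^ 2 / 2 / (4 * vmin ^ 2)))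
    {γ : ℝ → DvocState N} {T : ℝ} (hsol : W.IsSolutionOn γ (Set.Icc 0 T))
    (h0V : 1 / 2 * W.normS2 (γ 0) ≤ d ^ 2 / 2) (h0r : ρ ^ 2 ≤ W.rSq (γ 0)) :
    ∀ t ∈ Set.Icc 0 T, 1 / 2 * W.normS2 (γ t) ≤ d ^ 2 / 2 ∧ ρ ^ 2 ≤ W.rSq (γ t) := by
  have hne : ∀ k, W.vref k ≠ 0 := fun k => (hvmin.trans_le (hv k)).ne'
  have hΛpos := W.Lam_pos_of_ne hΛ
  refine two_face_invariance (f := fun τ => 1 / 2 * W.normS2 (γ τ))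
    (f' := fun τ => W.η * W.qS (γ τ) (W.gVec (γ τ))) (g := fun τ => W.rSq (γ τ))
    (g' := fun τ => 2 * W.η / W.Lam ^ 2 * (W.sig₁ (γ τ) * W.sig₁ (W.gVec (γ τ))
      + W.sig₂ (γ τ) * W.sig₂ (W.gVec (γ τ))))
    (fun t ht => W.hasDerivWithinAt_half_normS2 (hsol t ht))
    (fun t ht => W.hasDerivWithinAt_rSq (hsol t ht)) ?_ ?_ h0V h0r
  · -- face `½‖P_S v‖² = ℓ`: strict decrease from Prop 3♯ on the region
    intro t ht hfeq hr
    have hq := W.qS_gVec_le_of_region hΛ hα hvmin hv h23 (γ t) (le_of_eq hfeq) (by linarith)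
    have hn : W.normS2 (γ t) = d ^ 2 := by linarith
    rw [hn] at hq
    have : W.η * W.qS (γ t) (W.gVec (γ t)) ≤ W.η * (-c * d ^ 2) := mul_le_mul_of_nonneg_left hq hη.le
    have hneg : W.η * (-c * d ^ 2) < 0 := by
      have : 0 < W.η * (c * d ^ 2) := by positivity
      linarith
    exact this.trans_lt hneg
  · -- face `r² = ρ²`: strict increase from the barrier bound
    intro t ht hf hgeq
    have hb := W.barrier_bound hΛ hne hw hα hvmin hv hρ hd.le hSb hσ (γ t) hgeq (by linarith)
    have hpos : 0 < W.sig₁ (γ t) * W.sig₁ (W.gVec (γ t)) + W.sig₂ (γ t) * W.sig₂ (W.gVec (γ t)) :=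
      lt_of_lt_of_le (mul_pos hΛpos hBpos) hb
    positivity

/-- **With the over-voltage face: the closed band `Ω₃ = {½‖P_Sv‖² ≤ d²/2} ∩ {ρ² ≤ r² ≤ ρ₊²}` is
forward invariant** along every solution defined on `[0, T]` (second application of `two_face_invariance`,
upper face from `barrier_bound_upper`, given additionally `α(ρ₊²(1−ρ₊²)Λ + ρ₊d³/v_min) + 2ρ₊dΣ̄ < 0`).
[cite: ColombinoEtAl2019, Prop. 11 chunk p0017 L28–32 (printed analogue); GrossEtAl2019 (17) p0006 L9–16] -/
theorem region_invariant₃ (hΛ : W.Lam ≠ 0) (hw : ∀ k j, W.w k j = W.w j k) (hα : 0 ≤ W.α)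
    (hη : 0 < W.η) {vmin ρ ρp d Sb c : ℝ} (hvmin : 0 < vmin) (hv : ∀ k, vmin ≤ W.vref k)
    (hρ : 0 ≤ ρ) (hρp : 0 ≤ ρp) (hd : 0 < d) (hSb : 0 ≤ Sb)
    (hσ : ∑ k, (W.loadSig k / W.vref k) ^ 2 ≤ Sb ^ 2) (hc : 0 < c)
    (hBpos : 0 < W.α * (ρ ^ 2 * ((1 - ρ ^ 2) * W.Lam - 3 * d ^ 2) - ρ * d ^ 3 / vmin)
      - 2 * ρ * d * Sb)
    (hBup : W.α * (ρp ^ 2 * ((1 - ρp ^ 2) * W.Lam) + ρp * d ^ 3 / vmin) + 2 * ρp * d * Sb < 0)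
    (h23 : W.GateDecrease c ((1 - ρ ^ 2) + d ^ 2 / 2 / (4 * vmin ^ 2)))
    {γ : ℝ → DvocState N} {T : ℝ} (hsol : W.IsSolutionOn γ (Set.Icc 0 T))
    (h0V : 1 / 2 * W.normS2 (γ 0) ≤ d ^ 2 / 2) (h0r : ρ ^ 2 ≤ W.rSq (γ 0))
    (h0rp : W.rSq (γ 0) ≤ ρp ^ 2) :
    ∀ t ∈ Set.Icc 0 T, 1 / 2 * W.normS2 (γ t) ≤ d ^ 2 / 2 ∧ ρ ^ 2 ≤ W.rSq (γ t)
      ∧ W.rSq (γ t) ≤ ρp ^ 2 := by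
  have hne : ∀ k, W.vref k ≠ 0 := fun k => (hvmin.trans_le (hv k)).ne'
  have hΛpos := W.Lam_pos_of_ne hΛ
  have hinv := W.region_invariant hΛ hw hα hη hvmin hv hρ hd hSb hσ hc hBpos h23 hsol h0V h0r
  have hup := two_face_invariance (f := fun τ => 1 / 2 * W.normS2 (γ τ))
    (f' := fun τ => W.η * W.qS (γ τ) (W.gVec (γ τ))) (g := fun τ => -W.rSq (γ τ))
    (g' := fun τ => -(2 * W.η / W.Lam ^ 2 * (W.sig₁ (γ τ) * W.sig₁ (W.gVec (γ τ))
      + W.sig₂ (γ τ) * W.sig₂ (W.gVec (γ τ))))) (T := T) (ℓ := d ^ 2 / 2) (ρ2 := -ρp ^ 2)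
    (fun t ht => W.hasDerivWithinAt_half_normS2 (hsol t ht))
    (fun t ht => (W.hasDerivWithinAt_rSq (hsol t ht)).neg) ?_ ?_ h0V (by linarith)
  · intro t ht
    obtain ⟨h1, h2⟩ := hinv t ht
    exact ⟨h1, h2, by linarith [(hup t ht).2]⟩
  · -- face `½‖P_S v‖² = ℓ` (uses only the lower amplitude bound, from `hinv`)
    intro t ht hfeq _
    have hr := (hinv t ht).2
    have hq := W.qS_gVec_le_of_region hΛ hα hvmin hv h23 (γ t) (le_of_eq hfeq) (by linarith)
    have hn : W.normS2 (γ t) = d ^ 2 := by linarith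
    rw [hn] at hq
    have : W.η * W.qS (γ t) (W.gVec (γ t)) ≤ W.η * (-c * d ^ 2) := mul_le_mul_of_nonneg_left hq hη.le
    have hneg : W.η * (-c * d ^ 2) < 0 := by
      have : 0 < W.η * (c * d ^ 2) := by positivity
      linarith
    exact this.trans_lt hneg
  · -- face `r² = ρ₊²`: strict decrease of `r²` from the upper barrier bound
    intro t ht hf hgeq
    have hr : W.rSq (γ t) = ρp ^ 2 := by linarith
    have hb := W.barrier_bound_upper hΛ hne hw hα hvmin hv hρp hd.le hSb hσ (γ t) hr (by linarith)
    have hneg : W.sig₁ (γ t) * W.sig₁ (W.gVec (γ t)) + W.sig₂ (γ t) * W.sig₂ (W.gVec (γ t)) < 0 :=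
      lt_of_le_of_lt hb (by nlinarith [mul_neg_of_pos_of_neg hΛpos hBup])
    have : 2 * W.η / W.Lam ^ 2 * (W.sig₁ (γ t) * W.sig₁ (W.gVec (γ t))
        + W.sig₂ (γ t) * W.sig₂ (W.gVec (γ t))) < 0 :=
      mul_neg_of_pos_of_neg (by positivity) hneg
    linarith


/-- **Prop 3♯ integrated on `Ω`: regional exponential synchronisation** — under the hypotheses of
`region_invariant`, every solution defined on `[0, T]` and starting in `Ω` satisfies
`‖v(t)‖²_S ≤ e^{−2ηct}‖v(0)‖²_S` on `[0, T]` (and stays in `Ω`): the printed (25) integrated, with (23) at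
the REDUCED gain `α(ε₁ + ℓ/(4v_min²))` and the conclusion REGIONAL — valid for every `α ≥ 0`, every `N`.
[cite: GrossEtAl2019, Prop. 3 (25) p0006 L96–100 and Thm 2 p0005 L69–76] -/
theorem region_exp_decay (hΛ : W.Lam ≠ 0) (hw : ∀ k j, W.w k j = W.w j k) (hα : 0 ≤ W.α)
    (hη : 0 < W.η) {vmin ρ d Sb c : ℝ} (hvmin : 0 < vmin) (hv : ∀ k, vmin ≤ W.vref k)
    (hρ : 0 ≤ ρ) (hd : 0 < d) (hSb : 0 ≤ Sb) (hσ : ∑ k, (W.loadSig k / W.vref k) ^ 2 ≤ Sb ^ 2)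
    (hc : 0 < c)
    (hBpos : 0 < W.α * (ρ ^ 2 * ((1 - ρ ^ 2) * W.Lam - 3 * d ^ 2) - ρ * d ^ 3 / vmin)
      - 2 * ρ * d * Sb)
    (h23 : W.GateDecrease c ((1 - ρ ^ 2) + d ^ 2 / 2 / (4 * vmin ^ 2)))
    {γ : ℝ → DvocState N} {T : ℝ} (hsol : W.IsSolutionOn γ (Set.Icc 0 T))
    (h0V : 1 / 2 * W.normS2 (γ 0) ≤ d ^ 2 / 2) (h0r : ρ ^ 2 ≤ W.rSq (γ 0))
    {t : ℝ} (ht : t ∈ Set.Icc 0 T) :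
    W.normS2 (γ t) ≤ Real.exp (-(2 * W.η * c * t)) * W.normS2 (γ 0) := by
  have hne : ∀ k, W.vref k ≠ 0 := fun k => (hvmin.trans_le (hv k)).ne'
  have hinv := W.region_invariant hΛ hw hα hη hvmin hv hρ hd hSb hσ hc hBpos h23 hsol h0V h0r
  refine W.normS2_le_exp_decay_of_gate hΛ hne hη.le hα h23 hsol (fun τ hτ => ?_) ht
  obtain ⟨hV, hr⟩ := hinv τ hτ
  exact ⟨by linarith, W.gate_of_region hΛ hvmin hv (γ τ) (by linarith)⟩

/-- **Exponential convergence of the COLLECTIVE AMPLITUDE on the band.**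
On `Ω₃` (hypotheses of `region_invariant₃`) with `c < αρ²`, for every `t ∈ [0,T]`,
`(1 − r(t)²)² ≤ e^{−2ηαρ² t}(1 − r(0)²)² + K_r/(αρ²Λ²(αρ² − c))·e^{−2ηct}·‖v(0)‖²_S` — phases AND the common
amplitude converge exponentially: approach to `𝒯 = 𝒮 ∩ 𝒜` from the O(1)-in-`N` region `Ω₃` along every
solution defined on `[0, T]` (comparison function `Ψ(t) = e^{2κt}(1−r²)² − (G‖v(0)‖²_S/m)e^{mt}`, Young's
inequality `amp_pointwise`, remainder `pairing_remainder_sq_le`). Printed counterpart: Thm 2's «almost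
globally asymptotically stable with respect to 𝒯» under the FULL-gain Condition 2 (no rate, no region).
[cite: GrossEtAl2019, Thm 2 p0005 L69–76; ColombinoEtAl2019 Prop. 10/11 chunk p0015 L56–75, p0017 L28–32] -/
theorem amp_sq_decay (hΛ : W.Lam ≠ 0) (hw : ∀ k j, W.w k j = W.w j k) (hα : 0 < W.α)
    (hη : 0 < W.η) {vmin ρ ρp d Sb c : ℝ} (hvmin : 0 < vmin) (hv : ∀ k, vmin ≤ W.vref k)
    (hρ : 0 < ρ) (hρp : 0 ≤ ρp) (hd : 0 < d) (hSb : 0 ≤ Sb)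
    (hσ : ∑ k, (W.loadSig k / W.vref k) ^ 2 ≤ Sb ^ 2) (hc : 0 < c) (hcα : c < W.α * ρ ^ 2)
    (hBpos : 0 < W.α * (ρ ^ 2 * ((1 - ρ ^ 2) * W.Lam - 3 * d ^ 2) - ρ * d ^ 3 / vmin)
      - 2 * ρ * d * Sb)
    (hBup : W.α * (ρp ^ 2 * ((1 - ρp ^ 2) * W.Lam) + ρp * d ^ 3 / vmin) + 2 * ρp * d * Sb < 0)
    (h23 : W.GateDecrease c ((1 - ρ ^ 2) + d ^ 2 / 2 / (4 * vmin ^ 2)))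
    {γ : ℝ → DvocState N} {T : ℝ} (hsol : W.IsSolutionOn γ (Set.Icc 0 T))
    (h0V : 1 / 2 * W.normS2 (γ 0) ≤ d ^ 2 / 2) (h0r : ρ ^ 2 ≤ W.rSq (γ 0))
    (h0rp : W.rSq (γ 0) ≤ ρp ^ 2) {t : ℝ} (ht : t ∈ Set.Icc 0 T) :
    (1 - W.rSq (γ t)) ^ 2
      ≤ Real.exp (-(2 * (W.η * W.α * ρ ^ 2) * t)) * (1 - W.rSq (γ 0)) ^ 2
        + 3 * ((W.α * ρp ^ 2 * d) ^ 2 + (W.α * (2 * ρp ^ 2 + ρp * d / vmin) * d) ^ 2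
            + (2 * Sb * ρp) ^ 2) / (W.α * ρ ^ 2 * W.Lam ^ 2 * (W.α * ρ ^ 2 - c))
          * Real.exp (-(2 * W.η * c * t)) * W.normS2 (γ 0) := by
  have hne : ∀ k, W.vref k ≠ 0 := fun k => (hvmin.trans_le (hv k)).ne'
  have hΛpos := W.Lam_pos_of_ne hΛ
  have hband := W.region_invariant₃ hΛ hw hα.le hη hvmin hv hρ.le hρp hd hSb hσ hc hBpos hBup h23
    hsol h0V h0r h0rp
  have hdec : ∀ τ ∈ Set.Icc (0:ℝ) T,
      W.normS2 (γ τ) ≤ Real.exp (-(2 * W.η * c * τ)) * W.normS2 (γ 0) :=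
    fun τ hτ => W.region_exp_decay hΛ hw hα.le hη hvmin hv hρ.le hd hSb hσ hc hBpos h23 hsol h0V h0r hτ
  set Kr := 3 * ((W.α * ρp ^ 2 * d) ^ 2 + (W.α * (2 * ρp ^ 2 + ρp * d / vmin) * d) ^ 2
    + (2 * Sb * ρp) ^ 2) with hKr
  set κ := W.η * W.α * ρ ^ 2 with hκ
  set G := 2 * W.η * Kr / (W.α * ρ ^ 2 * W.Lam ^ 2) with hG
  set N0 := W.normS2 (γ 0) with hN0
  set m := 2 * κ - 2 * W.η * c with hm
  have hm_pos : 0 < m := by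
    have : 0 < W.η * (W.α * ρ ^ 2 - c) := mul_pos hη (sub_pos.2 hcα)
    rw [hm, hκ]; nlinarith
  have hKr0 : 0 ≤ Kr := by rw [hKr]; positivity
  have hG0 : 0 ≤ G := by rw [hG]; positivity
  have hN00 : 0 ≤ N0 := W.normS2_nonneg hΛ _
  -- the amplitude deficit u, the pairing P, and u' = −(2η/Λ²)P
  set u : ℝ → ℝ := fun σ => 1 - W.rSq (γ σ) with hu
  set P : ℝ → ℝ := fun σ => W.sig₁ (γ σ) * W.sig₁ (W.gVec (γ σ))
    + W.sig₂ (γ σ) * W.sig₂ (W.gVec (γ σ)) with hP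
  have hud : ∀ τ ∈ Set.Icc (0:ℝ) T,
      HasDerivWithinAt u (-(2 * W.η / W.Lam ^ 2 * P τ)) (Set.Icc 0 T) τ :=
    fun τ hτ => (W.hasDerivWithinAt_rSq (hsol τ hτ)).const_sub 1
  -- the comparison function Ψ and its derivative
  have hΨd : ∀ τ ∈ Set.Icc (0:ℝ) T, HasDerivWithinAt
      (fun σ => Real.exp (2 * κ * σ) * (u σ * u σ) - G * N0 / m * Real.exp (m * σ))
      (Real.exp (2 * κ * τ) * (2 * κ * 1) * (u τ * u τ)
        + Real.exp (2 * κ * τ) * (-(2 * W.η / W.Lam ^ 2 * P τ) * u τ + u τ * -(2 * W.η / W.Lam ^ 2 * P τ))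
        - G * N0 / m * (Real.exp (m * τ) * (m * 1))) (Set.Icc 0 T) τ := by
    intro τ hτ
    have he : HasDerivWithinAt (fun σ => Real.exp (2 * κ * σ)) (Real.exp (2 * κ * τ) * (2 * κ * 1))
        (Set.Icc 0 T) τ :=
      (((hasDerivAt_id τ).const_mul (2 * κ)).exp).hasDerivWithinAt
    have he2 : HasDerivWithinAt (fun σ => Real.exp (m * σ)) (Real.exp (m * τ) * (m * 1))
        (Set.Icc 0 T) τ :=
      (((hasDerivAt_id τ).const_mul m).exp).hasDerivWithinAt
    exact (he.mul ((hud τ hτ).mul (hud τ hτ))).sub (he2.const_mul (G * N0 / m))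
  have hanti : AntitoneOn
      (fun σ => Real.exp (2 * κ * σ) * (u σ * u σ) - G * N0 / m * Real.exp (m * σ)) (Set.Icc 0 T) := by
    refine antitoneOn_of_hasDerivWithinAt_nonpos
      (f' := fun τ => Real.exp (2 * κ * τ) * (2 * κ * 1) * (u τ * u τ)
        + Real.exp (2 * κ * τ) * (-(2 * W.η / W.Lam ^ 2 * P τ) * u τ + u τ * -(2 * W.η / W.Lam ^ 2 * P τ))
        - G * N0 / m * (Real.exp (m * τ) * (m * 1)))
      (convex_Icc 0 T) (fun τ hτ => (hΨd τ hτ).continuousWithinAt)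
      (fun τ hτ => (hΨd τ (interior_subset hτ)).mono interior_subset) (fun τ hτ => ?_)
    have hτ' : τ ∈ Set.Icc 0 T := interior_subset hτ
    obtain ⟨hV, hr, hrp⟩ := hband τ hτ'
    have hR2 := W.pairing_remainder_sq_le hΛ hne hw hvmin hv hρp hd.le hσ (γ τ) hrp (by linarith)
    rw [← hKr] at hR2
    have key := amp_pointwise (u := u τ) (P := P τ) (n := W.normS2 (γ τ)) hη hα hΛpos hρ hr rfl hR2
    -- key : 2κ u² + 2 u u' ≤ G · ‖v(τ)‖²_S
    have hGn : G * W.normS2 (γ τ) ≤ G * (Real.exp (-(2 * W.η * c * τ)) * N0) :=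
      mul_le_mul_of_nonneg_left (hdec τ hτ') hG0
    have hexp : Real.exp (2 * κ * τ) * Real.exp (-(2 * W.η * c * τ)) = Real.exp (m * τ) := by
      rw [← Real.exp_add]; congr 1; rw [hm]; ring
    have he0 : 0 < Real.exp (2 * κ * τ) := Real.exp_pos _
    have e1 : Real.exp (2 * κ * τ) * (2 * κ * 1) * (u τ * u τ)
        + Real.exp (2 * κ * τ) * (-(2 * W.η / W.Lam ^ 2 * P τ) * u τ + u τ * -(2 * W.η / W.Lam ^ 2 * P τ))
        - G * N0 / m * (Real.exp (m * τ) * (m * 1))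
        = Real.exp (2 * κ * τ) * (2 * (W.η * W.α * ρ ^ 2) * u τ ^ 2 + 2 * u τ * (-(2 * W.η / W.Lam ^ 2 * P τ)))
          - G * N0 * Real.exp (m * τ) := by
      rw [hκ]; field_simp; ring
    rw [e1, ← hexp]
    have h2 : Real.exp (2 * κ * τ) * (2 * (W.η * W.α * ρ ^ 2) * u τ ^ 2
        + 2 * u τ * (-(2 * W.η / W.Lam ^ 2 * P τ)))
        ≤ Real.exp (2 * κ * τ) * (G * W.normS2 (γ τ)) := by
      apply mul_le_mul_of_nonneg_left _ he0.le
      rw [hG]; exact key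
    have h3 := mul_le_mul_of_nonneg_left hGn he0.le
    have e4 : G * N0 * (Real.exp (2 * κ * τ) * Real.exp (-(2 * W.η * c * τ)))
        = Real.exp (2 * κ * τ) * (G * (Real.exp (-(2 * W.η * c * τ)) * N0)) := by ring
    rw [e4]
    linarith [h2, h3]
  -- integrate: Ψ t ≤ Ψ 0
  have h0 : (0 : ℝ) ∈ Set.Icc 0 T := Set.left_mem_Icc.2 (ht.1.trans ht.2)
  have hmono := hanti h0 ht ht.1
  simp only [mul_zero, Real.exp_zero, one_mul, mul_one] at hmono
  -- hmono : exp(2κt) u(t)² − (G N0/m) exp(m t) ≤ u(0)² − G N0/m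
  have hGm0 : 0 ≤ G * N0 / m := by positivity
  have het : 0 < Real.exp (-(2 * κ * t)) := Real.exp_pos _
  have hprod : Real.exp (-(2 * κ * t)) * Real.exp (2 * κ * t) = 1 := by
    rw [← Real.exp_add, neg_add_cancel, Real.exp_zero]
  have hprod2 : Real.exp (-(2 * κ * t)) * Real.exp (m * t) = Real.exp (-(2 * W.η * c * t)) := by
    rw [← Real.exp_add]; congr 1; rw [hm]; ring
  have eGm : G / m = Kr / (W.α * ρ ^ 2 * W.Lam ^ 2 * (W.α * ρ ^ 2 - c)) := by
    rw [hG, hm, hκ]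
    have h1 : W.α * ρ ^ 2 - c ≠ 0 := (sub_pos.2 hcα).ne'
    field_simp
  have hu2 : (1 - W.rSq (γ t)) ^ 2 = u t * u t := by rw [hu]; ring
  have hu0 : (1 - W.rSq (γ 0)) ^ 2 = u 0 * u 0 := by rw [hu]; ring
  rw [hu2, hu0, ← eGm]
  calc u t * u t = Real.exp (-(2 * κ * t)) * (Real.exp (2 * κ * t) * (u t * u t)) := by
        rw [← mul_assoc, hprod, one_mul]
    _ ≤ Real.exp (-(2 * κ * t)) * (u 0 * u 0 + G * N0 / m * Real.exp (m * t)) := by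
        apply mul_le_mul_of_nonneg_left _ het.le
        linarith
    _ = Real.exp (-(2 * κ * t)) * (u 0 * u 0) + G / m * Real.exp (-(2 * W.η * c * t)) * N0 := by
        rw [← hprod2]; ring
    _ = Real.exp (-(2 * (W.η * W.α * ρ ^ 2) * t)) * (u 0 * u 0)
        + G / m * Real.exp (-(2 * W.η * c * t)) * N0 := by rw [hκ]

end DvocReduced

end Literature.MathematicalPhysics.PowerSystems
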